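import Summits.CriticalPhenomena.Ising3DConformalLimit.Theses.LinkingParityCircles
import Summits.CriticalPhenomena.Ising3DConformalLimit.Theorems.MoebiusLimitExists.Negative.FreeTranslations
import Summits.CriticalPhenomena.Ising3DConformalLimit.Theorems.RotationUpgradeFromTwoPoint.Negative.ContinuityFree
import Summits.CriticalPhenomena.Ising3DConformalLimit.Theorems.HyperoctahedralRPLimitRotationInvariant
import Summits.CriticalPhenomena.Ising3DConformalLimit.Theorems.HyperoctahedralRPHRP2Rigidity
import Summits.CriticalPhenomena.Ising3DConformalLimit.Theorems.LinkingParityCirclesSpinRatioMoebiusStubCellLimitTranslate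
import Summits.CriticalPhenomena.Ising3DConformalLimit.Theorems.LinkingParityCirclesSpinRatioMoebiusStubCellLimitContinuous
import Summits.CriticalPhenomena.Ising3DConformalLimit.Theorems.LinkingParityCirclesSpinRatioMoebiusStubTwoPointOfRatioLimit
import Summits.CriticalPhenomena.Ising3DConformalLimit.Theorems.LinkingParityCirclesSpinRatioMoebiusStubScalingLimitOfRatioLimit
import Summits.CriticalPhenomena.Ising3DConformalLimit.Theorems.LinkingParityCirclesSpinRatioMoebiusRatioLimitExistsOfCCI
import Summits.CriticalPhenomena.Ising3DConformalLimit.Theses.HyperoctahedralRP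
import Literature.Probability.LatticeModels.HighDimPointwiseTriviality
import HarnessLib

/-!
# Crux `LinkingParityCircles.SpinRatioMoebius` (stmt-CriticalPhenomena-4530) — skeleton of line `registered`
# (lead prover-line-stmt-CriticalPhenomena-4530-0; reshape 1 of the birth skeleton `Lines/birth.lean`)

The crux (rank 4 of route `LinkingParityCircles`, "the k = 0 corner"): there is a family `q : CorrFamily 3`,
Möbius covariant with weight `0` (INVARIANT under translations, `O(3)`, dilations and the unit inversion), such
that for every `m` the weight-free spin pairing ratio
`Q^δ_m(x) = ⟨σ_{[x₀/δ]}⋯σ_{[x_{2m−1}/δ]}⟩⁺_{β_c} / ∏_{j<m} ⟨σ_{[x_j/δ]}σ_{[x_{j+m}/δ]}⟩⁺_{β_c}` (= `pairingRatio m δ x`)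
converges to `q (m+m)` as `δ → 0⁺`, locally uniformly on `NonCoincident 3 (m+m)`.

## Reshape 1 (this lead): EUCLIDEAN INVARIANCE IS FREE — two open stubs remain (state after cycle 1)

The birth skeleton cut the crux along the generators of Möb(3) into four lattice statements (convergence,
translation, rotation, inversion).  This reshape PROVES that the translation and rotation statements follow from
convergence alone, using structure already landed in the tree; all four provable stubs are now LANDED:

* `stub_cellLimitTranslate` (p148702, `Theorems/LinkingParityCirclesSpinRatioMoebiusStubCellLimitTranslate.lean`):
  translation invariance of any mesh limit of a lattice-shift-invariant family is automatic (the tree's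
  `limit_translate` mechanism: along `δ_k = t/(k+1)` translation by `t m̂` is a lattice translation);
* `stub_cellLimitContinuous` (p151155, `…StubCellLimitContinuous.lean`): continuity of such limits is automatic (the
  tree's cellmate-shift pigeonhole `exists_cellmate_shift`);
* `stub_twoPointOfRatioLimit` (p152013, `…StubTwoPointOfRatioLimit.lean` with helpers `…TwoPointPrelim.lean` p151052,
  `…TwoPointConfigs.lean` p151749): from the ratio limit at level `m = 2` alone the PINNED two-point function
  `⟨σ_{[x/δ]}σ_{[y/δ]}⟩ / ⟨σ₀σ_{⌊1/δ⌋e₀}⟩` has a locally uniform limit `ψ(y − x)`, `ψ` continuous, positive and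
  homogeneous of some degree `−2Δ` (exact identity `K_δ² Q^δ_2(0,δk,u,u+δk) = Q^δ_2(0,u,δk,u+δk)`, `k = ⌊1/δ⌋eᵢ`; GKS
  `Q ≥ 1`; continuity of `q4`; the continuous Cauchy equation);
* `stub_scalingLimitOfRatioLimit` (p151899, `…StubScalingLimitOfRatioLimit.lean`): the pinned rescaled correlators
  `ρ(δ)ⁿ⟨∏σ_{[xᵢ/δ]}⟩`, `ρ(δ)² = 1/⟨σ₀σ_{⌊1/δ⌋e₀}⟩`, HAVE a pointwise scaling limit `S` (`S_{2m} = q_{2m} ∏_j ψ(x_{m+j} − x_j)`,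
  `S_odd = 0`), normalised, non-degenerate, translation invariant, scale covariant with dimension `Δ`;
* and EVERY such limit is `O(3)`-invariant at all orders by the landed theorems of route `HyperoctahedralRP`
  (`HRP2Rigidity_of`, item 1979; `limitRotationInvariant_proof`, item 1980 via 8367), so `q_{2m} = S_{2m}/∏S_2` is
  `O(3)`-invariant (`ratioLimit_rotate`).  Dilations were already free (`pairingRatio_smul`).

What remains OPEN is exactly: `stub_ratioLimitExists` (existence = uniqueness of the ratio limits; XL; ⇐ item
stmt-CriticalPhenomena-4841 `CurrentConnectionInvariance.RatioLimit`) and `stub_ratioInversion` (asymptotic invariance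
under the unit inversion on the lattice — conformal invariance proper; XL; ⇐ `stub_ratioLimitExists` ∧ item
stmt-CriticalPhenomena-1982 `HyperoctahedralRP.InversionUpgradeNormalised`, kernel-checked in §8:
`SpinRatioMoebius_of_ratioLimitExists_of_inversionUpgrade`).

## Composition

`SpinRatioMoebius_of : Sig.stub_ratioLimitExists → Sig.stub_ratioInversion → Sig.stub_cellLimitTranslate →
Sig.stub_cellLimitContinuous → Sig.stub_twoPointOfRatioLimit → Sig.stub_scalingLimitOfRatioLimit →
LinkingParityCircles.SpinRatioMoebius` (sorry-free) concludes the route decl BY NAME; `SpinRatioMoebius_of_stubs`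
feeds it the two OPEN registered stubs and the four LANDED ones.  Corollaries recorded for the planners: the birth
stubs `Sig.stub_ratioTranslation` and `Sig.stub_ratioRotation` FOLLOW from `Sig.stub_ratioLimitExists` (§7), and the
crux follows from `Sig.stub_ratioLimitExists ∧ HyperoctahedralRP.InversionUpgradeNormalised`, hence from the two OPEN
sibling items `CurrentConnectionInvariance.RatioLimit` (4841, via the landed bridge `ratioLimitExists_of_CCIRatioLimit`) and
`HyperoctahedralRP.InversionUpgradeNormalised` (1982) alone (§8, `SpinRatioMoebius_of_CCIRatioLimit_of_inversionUpgrade`).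

Disproof used: none exists for this crux (`ledger crux ls`, 2026-08-17).  Wave 1 verdicts (stub-workers, this
lead's session): `stub_ratioLimitExists` blocked on open item 4841 (or 5355 `PrimaryAtInfinity.ExistsRegularLimit`);
`stub_ratioRotation` (birth form) blocked on open item 1981 — superseded by this reshape.
-/

noncomputable section

namespace Summit.CriticalPhenomena.Ising3DConformalLimit.Cruxes.SpinRatioMoebius.Birth

open Literature.Probability.LatticeModels
open Filter Topology
open Summit.CriticalPhenomena.Ising3DConformalLimit.Theses
open Summit.CriticalPhenomena.Ising3DConformalLimit.MoebiusLimitExistsNegative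
open Summit.CriticalPhenomena.Ising3DConformalLimit.Theorems.MoebiusLimitOfTwoPointLaw.Negative
  (latticeApprox_smul tendsto_div_const_nhdsGT)

/-! ## §0 The lattice pairing ratio (verbatim the approximant of the crux) -/

/-- `pairingRatio m δ x = ⟨σ_{[x₀/δ]}⋯σ_{[x_{2m-1}/δ]}⟩⁺_{β_c(3)} / ∏_{j<m} ⟨σ_{[x_j/δ]}σ_{[x_{j+m}/δ]}⟩⁺_{β_c(3)}`:
the weight-free spin pairing ratio of the crux at mesh `δ` (no renormalisation `ρ`: it cancels). -/
def pairingRatio (m : ℕ) (δ : ℝ) (x : Fin (m + m) → EuclideanSpace ℝ (Fin 3)) : ℝ :=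
  criticalCorr 3 (m + m) (fun i => latticeApprox δ (x i)) /
    ∏ j : Fin m, criticalCorr 3 2 ![latticeApprox δ (x (Fin.castAdd m j)), latticeApprox δ (x (Fin.natAdd m j))]

/-! ## §1 The stub statements as named propositions (verbatim the registered signatures) -/

/-- Statement of `stub_ratioLimitExists` (OPEN). -/
def Sig.stub_ratioLimitExists : Prop :=
  ∃ q : Literature.Probability.LatticeModels.CorrFamily 3, ∀ m : ℕ, TendstoLocallyUniformlyOn (fun (δ : ℝ) (x : Fin (m + m) → EuclideanSpace ℝ (Fin 3)) => Literature.Probability.LatticeModels.criticalCorr 3 (m + m) (fun i => Literature.Probability.LatticeModels.latticeApprox δ (x i)) / ∏ j : Fin m, Literature.Probability.LatticeModels.criticalCorr 3 2 ![Literature.Probability.LatticeModels.latticeApprox δ (x (Fin.castAdd m j)), Literature.Probability.LatticeModels.latticeApprox δ (x (Fin.natAdd m j))]) (q (m + m)) (nhdsWithin 0 (Set.Ioi 0)) (Literature.Probability.LatticeModels.NonCoincident 3 (m + m))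

/-- Statement of `stub_ratioInversion` (OPEN). -/
def Sig.stub_ratioInversion : Prop :=
  ∀ (m : ℕ), ∀ x ∈ Literature.Probability.LatticeModels.NonCoincident 3 (m + m), (∀ i, x i ≠ 0) → Filter.Tendsto (fun δ : ℝ => Literature.Probability.LatticeModels.criticalCorr 3 (m + m) (fun i => Literature.Probability.LatticeModels.latticeApprox δ (EuclideanGeometry.inversion 0 1 (x i))) / (∏ j : Fin m, Literature.Probability.LatticeModels.criticalCorr 3 2 ![Literature.Probability.LatticeModels.latticeApprox δ (EuclideanGeometry.inversion 0 1 (x (Fin.castAdd m j))), Literature.Probability.LatticeModels.latticeApprox δ (EuclideanGeometry.inversion 0 1 (x (Fin.natAdd m j)))]) - Literature.Probability.LatticeModels.criticalCorr 3 (m + m) (fun i => Literature.Probability.LatticeModels.latticeApprox δ (x i)) / (∏ j : Fin m, Literature.Probability.LatticeModels.criticalCorr 3 2 ![Literature.Probability.LatticeModels.latticeApprox δ (x (Fin.castAdd m j)), Literature.Probability.LatticeModels.latticeApprox δ (x (Fin.natAdd m j))])) (nhdsWithin 0 (Set.Ioi 0)) (nhds 0)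

/-- Statement of `stub_cellLimitTranslate` (provable now; landed by this lead). -/
def Sig.stub_cellLimitTranslate : Prop :=
  ∀ (n : ℕ) (F : ℝ → (Fin n → EuclideanSpace ℝ (Fin 3)) → ℝ) (g : (Fin n → EuclideanSpace ℝ (Fin 3)) → ℝ), (∀ δ : ℝ, 0 < δ → ∀ (x : Fin n → EuclideanSpace ℝ (Fin 3)) (k : Literature.Probability.LatticeModels.Site 3), F δ (fun i => x i + δ • Literature.Probability.LatticeModels.siteVec k) = F δ x) → TendstoLocallyUniformlyOn F g (nhdsWithin 0 (Set.Ioi 0)) (Literature.Probability.LatticeModels.NonCoincident 3 n) → ∀ (v : EuclideanSpace ℝ (Fin 3)), ∀ x ∈ Literature.Probability.LatticeModels.NonCoincident 3 n, g (fun i => x i + v) = g x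

/-- Statement of `stub_cellLimitContinuous` (provable now; landed by this lead). -/
def Sig.stub_cellLimitContinuous : Prop :=
  ∀ (n : ℕ) (F : ℝ → (Fin n → EuclideanSpace ℝ (Fin 3)) → ℝ) (g : (Fin n → EuclideanSpace ℝ (Fin 3)) → ℝ), (∀ δ : ℝ, 0 < δ → ∀ x y : Fin n → EuclideanSpace ℝ (Fin 3), (∀ i j, ⌊x i j / δ⌋ = ⌊y i j / δ⌋) → F δ x = F δ y) → (∀ (v : EuclideanSpace ℝ (Fin 3)), ∀ x ∈ Literature.Probability.LatticeModels.NonCoincident 3 n, g (fun i => x i + v) = g x) → TendstoLocallyUniformlyOn F g (nhdsWithin 0 (Set.Ioi 0)) (Literature.Probability.LatticeModels.NonCoincident 3 n) → ContinuousOn g (Literature.Probability.LatticeModels.NonCoincident 3 n)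

/-- Statement of `stub_twoPointOfRatioLimit` (provable now). -/
def Sig.stub_twoPointOfRatioLimit : Prop :=
  ∀ (q4 : (Fin (2 + 2) → EuclideanSpace ℝ (Fin 3)) → ℝ), TendstoLocallyUniformlyOn (fun (δ : ℝ) (x : Fin (2 + 2) → EuclideanSpace ℝ (Fin 3)) => Literature.Probability.LatticeModels.criticalCorr 3 (2 + 2) (fun i => Literature.Probability.LatticeModels.latticeApprox δ (x i)) / ∏ j : Fin 2, Literature.Probability.LatticeModels.criticalCorr 3 2 ![Literature.Probability.LatticeModels.latticeApprox δ (x (Fin.castAdd 2 j)), Literature.Probability.LatticeModels.latticeApprox δ (x (Fin.natAdd 2 j))]) q4 (nhdsWithin 0 (Set.Ioi 0)) (Literature.Probability.LatticeModels.NonCoincident 3 (2 + 2)) → ContinuousOn q4 (Literature.Probability.LatticeModels.NonCoincident 3 (2 + 2)) → (∀ (v : EuclideanSpace ℝ (Fin 3)), ∀ x ∈ Literature.Probability.LatticeModels.NonCoincident 3 (2 + 2), q4 (fun i => x i + v) = q4 x) → ∃ (Δ : ℝ) (ψ : EuclideanSpace ℝ (Fin 3) → ℝ), ContinuousOn ψ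 {0}ᶜ ∧ (∀ u : EuclideanSpace ℝ (Fin 3), u ≠ 0 → 0 < ψ u) ∧ (∀ c : ℝ, 0 < c → ∀ u : EuclideanSpace ℝ (Fin 3), u ≠ 0 → ψ (c • u) = c ^ (-(2 * Δ)) * ψ u) ∧ TendstoLocallyUniformlyOn (fun (δ : ℝ) (x : Fin 2 → EuclideanSpace ℝ (Fin 3)) => Literature.Probability.LatticeModels.criticalCorr 3 2 (fun i => Literature.Probability.LatticeModels.latticeApprox δ (x i)) / Literature.Probability.LatticeModels.criticalCorr 3 2 ![(0 : Literature.Probability.LatticeModels.Site 3), Pi.single (0 : Fin 3) (⌊1 / δ⌋ : ℤ)]) (fun x => ψ (x 1 - x 0)) (nhdsWithin 0 (Set.Ioi 0)) (Literature.Probability.LatticeModels.NonCoincident 3 2)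

/-- Statement of `stub_scalingLimitOfRatioLimit` (provable now). -/
def Sig.stub_scalingLimitOfRatioLimit : Prop :=
  ∀ (q : Literature.Probability.LatticeModels.CorrFamily 3) (Δ : ℝ) (ψ : EuclideanSpace ℝ (Fin 3) → ℝ), (∀ m : ℕ, TendstoLocallyUniformlyOn (fun (δ : ℝ) (x : Fin (m + m) → EuclideanSpace ℝ (Fin 3)) => Literature.Probability.LatticeModels.criticalCorr 3 (m + m) (fun i => Literature.Probability.LatticeModels.latticeApprox δ (x i)) / ∏ j : Fin m, Literature.Probability.LatticeModels.criticalCorr 3 2 ![Literature.Probability.LatticeModels.latticeApprox δ (x (Fin.castAdd m j)), Literature.Probability.LatticeModels.latticeApprox δ (x (Fin.natAdd m j))]) (q (m + m)) (nhdsWithin 0 (Set.Ioi 0)) (Literature.Probability.LatticeModels.NonCoincident 3 (m + m))) → (∀ m : ℕ, ContinuousOn (q (m + m)) (Literature.Probability.LatticeModels.NonCoincident 3 (m + m))) → (∀ (m : ℕ) (v : EuclideanSpace ℝ (Fin 3)), ∀ x ∈ Literature.Probability.LatticeModels.NonCoincident 3 (m + m), q (m + m) (fun i => x i + v) = q (m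 + m) x) → (∀ (m : ℕ) (c : ℝ), 0 < c → ∀ x ∈ Literature.Probability.LatticeModels.NonCoincident 3 (m + m), q (m + m) (fun i => c • x i) = q (m + m) x) → ContinuousOn ψ {0}ᶜ → (∀ u : EuclideanSpace ℝ (Fin 3), u ≠ 0 → 0 < ψ u) → (∀ c : ℝ, 0 < c → ∀ u : EuclideanSpace ℝ (Fin 3), u ≠ 0 → ψ (c • u) = c ^ (-(2 * Δ)) * ψ u) → TendstoLocallyUniformlyOn (fun (δ : ℝ) (x : Fin 2 → EuclideanSpace ℝ (Fin 3)) => Literature.Probability.LatticeModels.criticalCorr 3 2 (fun i => Literature.Probability.LatticeModels.latticeApprox δ (x i)) / Literature.Probability.LatticeModels.criticalCorr 3 2 ![(0 : Literature.Probability.LatticeModels.Site 3), Pi.single (0 : Fin 3) (⌊1 / δ⌋ : ℤ)]) (fun x => ψ (x 1 - x 0)) (nhdsWithin 0 (Set.Ioi 0)) (Literature.Probability.LatticeModels.NonCoincident 3 2) → ∃ (ρ : ℝ → ℝ) (S : Literature.Probability.LatticeModels.CorrFamily 3), (∀ δ ∈ Set.Ioc (0 : ℝ) 1, 0 < ρ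 δ) ∧ Literature.Probability.LatticeModels.HasPointwiseScalingLimit (Literature.Probability.LatticeModels.criticalCorr 3) ρ S ∧ (∀ (n : ℕ) (z : Fin n → EuclideanSpace ℝ (Fin 3)), z ∉ Literature.Probability.LatticeModels.NonCoincident 3 n → S n z = 0) ∧ Literature.Probability.LatticeModels.IsNondegenerateTwoPoint S ∧ Literature.Probability.LatticeModels.IsTranslationInvariant S ∧ Literature.Probability.LatticeModels.IsScaleCovariant Δ S ∧ (∀ m : ℕ, ∀ x ∈ Literature.Probability.LatticeModels.NonCoincident 3 (m + m), S (m + m) x = q (m + m) x * ∏ j : Fin m, ψ (x (Fin.natAdd m j) - x (Fin.castAdd m j)))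

/-- Birth-skeleton statement `stub_ratioTranslation` (no longer a stub: a COROLLARY of `stub_ratioLimitExists`). -/
def Sig.stub_ratioTranslation : Prop :=
  ∀ (m : ℕ) (v : EuclideanSpace ℝ (Fin 3)), ∀ x ∈ Literature.Probability.LatticeModels.NonCoincident 3 (m + m), Filter.Tendsto (fun δ : ℝ => Literature.Probability.LatticeModels.criticalCorr 3 (m + m) (fun i => Literature.Probability.LatticeModels.latticeApprox δ (x i + v)) / (∏ j : Fin m, Literature.Probability.LatticeModels.criticalCorr 3 2 ![Literature.Probability.LatticeModels.latticeApprox δ (x (Fin.castAdd m j) + v), Literature.Probability.LatticeModels.latticeApprox δ (x (Fin.natAdd m j) + v)]) - Literature.Probability.LatticeModels.criticalCorr 3 (m + m) (fun i => Literature.Probability.LatticeModels.latticeApprox δ (x i)) / (∏ j : Fin m, Literature.Probability.LatticeModels.criticalCorr 3 2 ![Literature.Probability.LatticeModels.latticeApprox δ (x (Fin.castAdd m j)), Literature.Probability.LatticeModels.latticeApprox δ (x (Fin.natAdd m j))])) (nhdsWithin 0 (Set.Ioi 0)) (nhds 0)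

/-- Birth-skeleton statement `stub_ratioRotation` (no longer a stub: a COROLLARY of `stub_ratioLimitExists`). -/
def Sig.stub_ratioRotation : Prop :=
  ∀ (m : ℕ) (A : EuclideanSpace ℝ (Fin 3) ≃ₗᵢ[ℝ] EuclideanSpace ℝ (Fin 3)), ∀ x ∈ Literature.Probability.LatticeModels.NonCoincident 3 (m + m), Filter.Tendsto (fun δ : ℝ => Literature.Probability.LatticeModels.criticalCorr 3 (m + m) (fun i => Literature.Probability.LatticeModels.latticeApprox δ (A (x i))) / (∏ j : Fin m, Literature.Probability.LatticeModels.criticalCorr 3 2 ![Literature.Probability.LatticeModels.latticeApprox δ (A (x (Fin.castAdd m j))), Literature.Probability.LatticeModels.latticeApprox δ (A (x (Fin.natAdd m j)))]) - Literature.Probability.LatticeModels.criticalCorr 3 (m + m) (fun i => Literature.Probability.LatticeModels.latticeApprox δ (x i)) / (∏ j : Fin m, Literature.Probability.LatticeModels.criticalCorr 3 2 ![Literature.Probability.LatticeModels.latticeApprox δ (x (Fin.castAdd m j)), Literature.Probability.LatticeModels.latticeApprox δ (x (Fin.natAdd m j))])) (nhdsWithin 0 (Set.Ioi 0)) (nhds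 0)

/-! ## §2 Registered stubs (the ONLY `sorry`s of this file) -/

/-- **Stub 1 (CONVERGENCE of the pairing ratios; OPEN, XL).** Some family `q : CorrFamily 3` is, for every `m`,
the locally uniform limit as `δ → 0⁺` of `pairingRatio m δ ·` on `NonCoincident 3 (m+m)` (only the values
`q (m+m)` on the locus matter).  Existence of critical scaling limits on `ℤ³` (DuminilCopinICM2022 §8.4 p.29); for
`m ≥ 2` the uniqueness of subsequential limits of 4-point pairing ratios.  Wave-1 verdict: blocked on open item
4841 `CurrentConnectionInvariance.RatioLimit` (continuous positive limits of the telescoping ratios imply it by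
`Q_{m+1} = Q_m / R_{2m} ∘ perm`), alternatively 5355 `PrimaryAtInfinity.ExistsRegularLimit`. -/
theorem stub_ratioLimitExists :
    ∃ q : Literature.Probability.LatticeModels.CorrFamily 3, ∀ m : ℕ, TendstoLocallyUniformlyOn (fun (δ : ℝ) (x : Fin (m + m) → EuclideanSpace ℝ (Fin 3)) => Literature.Probability.LatticeModels.criticalCorr 3 (m + m) (fun i => Literature.Probability.LatticeModels.latticeApprox δ (x i)) / ∏ j : Fin m, Literature.Probability.LatticeModels.criticalCorr 3 2 ![Literature.Probability.LatticeModels.latticeApprox δ (x (Fin.castAdd m j)), Literature.Probability.LatticeModels.latticeApprox δ (x (Fin.natAdd m j))]) (q (m + m)) (nhdsWithin 0 (Set.Ioi 0)) (Literature.Probability.LatticeModels.NonCoincident 3 (m + m)) := by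
  sorry

/-- **Stub 2 (asymptotic UNIT-INVERSION invariance on the lattice — the Cardy-type target; OPEN, XL).** For
`x` non-coincident with every `x_i ≠ 0`, `pairingRatio m δ (ι∘x) − pairingRatio m δ x → 0` as `δ → 0⁺`,
`ι = EuclideanGeometry.inversion 0 1`.  Conformal invariance proper of 3D Ising pairing probabilities
(DuminilCopinICM2022 §8.4 p.29 "widely open"); the model-blind upgrade Euclid + scale ⇒ inversion is refuted
(`Literature.Barriers.CriticalPhenomena.ScaleCovarianceNotMoebius`), and the tree's Ising-specific upgrade
`HyperoctahedralRP.InversionUpgradeNormalised` (item 1982) is open. -/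
theorem stub_ratioInversion :
    ∀ (m : ℕ), ∀ x ∈ Literature.Probability.LatticeModels.NonCoincident 3 (m + m), (∀ i, x i ≠ 0) → Filter.Tendsto (fun δ : ℝ => Literature.Probability.LatticeModels.criticalCorr 3 (m + m) (fun i => Literature.Probability.LatticeModels.latticeApprox δ (EuclideanGeometry.inversion 0 1 (x i))) / (∏ j : Fin m, Literature.Probability.LatticeModels.criticalCorr 3 2 ![Literature.Probability.LatticeModels.latticeApprox δ (EuclideanGeometry.inversion 0 1 (x (Fin.castAdd m j))), Literature.Probability.LatticeModels.latticeApprox δ (EuclideanGeometry.inversion 0 1 (x (Fin.natAdd m j)))]) - Literature.Probability.LatticeModels.criticalCorr 3 (m + m) (fun i => Literature.Probability.LatticeModels.latticeApprox δ (x i)) / (∏ j : Fin m, Literature.Probability.LatticeModels.criticalCorr 3 2 ![Literature.Probability.LatticeModels.latticeApprox δ (x (Fin.castAdd m j)), Literature.Probability.LatticeModels.latticeApprox δ (x (Fin.natAdd m j))])) (nhdsWithin 0 (Set.Ioi 0)) (nhds 0) := by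
  sorry

-- Stubs 3 and 4 (`stub_cellLimitTranslate`, `stub_cellLimitContinuous`) are LANDED (p148702, p151155) and imported:
-- `Theorems/LinkingParityCirclesSpinRatioMoebiusStubCellLimitTranslate.lean`, `…StubCellLimitContinuous.lean`.

-- Stubs 5 and 6 (`stub_twoPointOfRatioLimit`, `stub_scalingLimitOfRatioLimit`) are LANDED (p152013, p151899) and imported:
-- `Theorems/LinkingParityCirclesSpinRatioMoebiusStubTwoPointOfRatioLimit.lean` (+ helpers `…TwoPointPrelim.lean`,
-- `…TwoPointConfigs.lean`), `Theorems/LinkingParityCirclesSpinRatioMoebiusStubScalingLimitOfRatioLimit.lean`.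

/-! ## §3 The stubs read through `pairingRatio` (kernel-checked identities) -/

theorem sig_ratioLimitExists_iff :
    Sig.stub_ratioLimitExists ↔ ∃ q : CorrFamily 3, ∀ m : ℕ,
      TendstoLocallyUniformlyOn (pairingRatio m) (q (m + m)) (𝓝[>] (0 : ℝ)) (NonCoincident 3 (m + m)) :=
  Iff.rfl

theorem sig_ratioTranslation_iff :
    Sig.stub_ratioTranslation ↔ ∀ (m : ℕ) (v : EuclideanSpace ℝ (Fin 3)), ∀ x ∈ NonCoincident 3 (m + m),
      Tendsto (fun δ : ℝ => pairingRatio m δ (fun i => x i + v) - pairingRatio m δ x) (𝓝[>] (0 : ℝ)) (𝓝 0) :=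
  Iff.rfl

theorem sig_ratioRotation_iff :
    Sig.stub_ratioRotation ↔ ∀ (m : ℕ) (A : EuclideanSpace ℝ (Fin 3) ≃ₗᵢ[ℝ] EuclideanSpace ℝ (Fin 3)),
      ∀ x ∈ NonCoincident 3 (m + m),
      Tendsto (fun δ : ℝ => pairingRatio m δ (fun i => A (x i)) - pairingRatio m δ x) (𝓝[>] (0 : ℝ)) (𝓝 0) :=
  Iff.rfl

theorem sig_ratioInversion_iff :
    Sig.stub_ratioInversion ↔ ∀ (m : ℕ), ∀ x ∈ NonCoincident 3 (m + m), (∀ i, x i ≠ 0) →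
      Tendsto (fun δ : ℝ => pairingRatio m δ (fun i => EuclideanGeometry.inversion 0 1 (x i)) - pairingRatio m δ x)
        (𝓝[>] (0 : ℝ)) (𝓝 0) :=
  Iff.rfl

/-! ## §4 Sorry-free glue, I: normalisation, exact lattice identities, limit uniqueness -/

open scoped Classical in
/-- The normalised family: the ratio limit at even levels on non-coincident configurations, `0` elsewhere
(odd levels, coincident configurations), where the crux's convergence clause says nothing. -/
def normalise (q : CorrFamily 3) : CorrFamily 3 := fun n x =>
  if Even n ∧ x ∈ NonCoincident 3 n then q n x else 0

theorem normalise_of_pos {q : CorrFamily 3} {n : ℕ} {x : Fin n → EuclideanSpace ℝ (Fin 3)}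
    (hn : Even n) (hx : x ∈ NonCoincident 3 n) : normalise q n x = q n x := by
  unfold normalise
  rw [if_pos ⟨hn, hx⟩]

theorem normalise_of_neg {q : CorrFamily 3} {n : ℕ} {x : Fin n → EuclideanSpace ℝ (Fin 3)}
    (h : ¬ (Even n ∧ x ∈ NonCoincident 3 n)) : normalise q n x = 0 := by
  unfold normalise
  rw [if_neg h]

/-- Injective maps of `ℝ³` preserve and reflect non-coincidence of configurations. -/
theorem comp_mem_nonCoincident_iff {n : ℕ} {φ : EuclideanSpace ℝ (Fin 3) → EuclideanSpace ℝ (Fin 3)}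
    (hφ : Function.Injective φ) (x : Fin n → EuclideanSpace ℝ (Fin 3)) :
    (fun i => φ (x i)) ∈ NonCoincident 3 n ↔ x ∈ NonCoincident 3 n := by
  simp only [mem_nonCoincident]
  exact ⟨fun h => Function.Injective.of_comp (f := φ) h, fun h => hφ.comp h⟩

/-- Hence the pairing ratio of the dilated configuration at mesh `δ` IS the pairing ratio at mesh `δ / c`. -/
theorem pairingRatio_smul (m : ℕ) (δ c : ℝ) (x : Fin (m + m) → EuclideanSpace ℝ (Fin 3)) :
    pairingRatio m δ (fun i => c • x i) = pairingRatio m (δ / c) x := by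
  simp only [pairingRatio, Theorems.MoebiusLimitOfTwoPointLaw.Negative.latticeApprox_smul]

/-- Hence the pairing ratio is invariant under the common lattice translations `xᵢ ↦ xᵢ + δ • k`
(translation invariance of `⟨·⟩⁺_{β_c}`, `criticalCorr_translate`). -/
theorem pairingRatio_shift {δ : ℝ} (hδ : 0 < δ) (m : ℕ) (x : Fin (m + m) → EuclideanSpace ℝ (Fin 3))
    (k : Site 3) : pairingRatio m δ (fun i => x i + δ • siteVec k) = pairingRatio m δ x := by
  unfold pairingRatio
  simp only [latticeApprox_add_mesh_smul' hδ]
  rw [criticalCorr_translate]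
  congr 1
  refine Finset.prod_congr rfl fun j _ => ?_
  have h : (![latticeApprox δ (x (Fin.castAdd m j)) + k, latticeApprox δ (x (Fin.natAdd m j)) + k] :
      Fin 2 → Site 3) =
      fun i => ![latticeApprox δ (x (Fin.castAdd m j)), latticeApprox δ (x (Fin.natAdd m j))] i + k := by
    funext i; fin_cases i <;> rfl
  rw [h, criticalCorr_translate]

/-- The pairing ratio is a CELL functional: it depends on `x` only through the cells `⌊x i j / δ⌋`. -/
theorem pairingRatio_cell (m : ℕ) (δ : ℝ) {x y : Fin (m + m) → EuclideanSpace ℝ (Fin 3)}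
    (h : ∀ i j, ⌊x i j / δ⌋ = ⌊y i j / δ⌋) : pairingRatio m δ x = pairingRatio m δ y := by
  have hL : ∀ i, latticeApprox δ (x i) = latticeApprox δ (y i) := fun i => funext fun j => by
    rw [latticeApprox_apply, latticeApprox_apply, h i j]
  unfold pairingRatio
  simp only [hL]

/-- At level `m = 1` the pairing ratio is identically `1` (`⟨σ_aσ_b⟩/⟨σ_aσ_b⟩`, the pair value being `> 0`). -/
theorem pairingRatio_one (δ : ℝ) (x : Fin (1 + 1) → EuclideanSpace ℝ (Fin 3)) : pairingRatio 1 δ x = 1 := by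
  unfold pairingRatio
  rw [Fin.prod_univ_one]
  have h : (fun i => latticeApprox δ (x i)) =
      ![latticeApprox δ (x (Fin.castAdd 1 0)), latticeApprox δ (x (Fin.natAdd 1 0))] := by
    funext i; fin_cases i <;> rfl
  rw [h]
  exact div_self (Cruxes.IsingEuclidUpgradeR4NonGaussian.FreeCovarianceDeltaDichotomy.criticalCorr_two_pos' _ _).ne'

/-- Limits along the mesh filter of asymptotically equal quantities are equal. -/
theorem eq_of_tendsto_sub {F G : ℝ → ℝ} {a b : ℝ}
    (hF : Tendsto F (𝓝[>] (0 : ℝ)) (𝓝 a)) (hG : Tendsto G (𝓝[>] (0 : ℝ)) (𝓝 b))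
    (h : Tendsto (fun δ => F δ - G δ) (𝓝[>] (0 : ℝ)) (𝓝 0)) : a = b := by
  have h' : Tendsto (fun δ => F δ - G δ) (𝓝[>] (0 : ℝ)) (𝓝 (a - b)) := hF.sub hG
  have hab : a - b = 0 := tendsto_nhds_unique h' h
  linarith

/-- SYMMETRY TRANSFER: a locally uniform ratio limit `g` takes equal values at two non-coincident configurations
whose lattice ratios are asymptotically equal along the mesh filter. -/
theorem limit_eq_of_asymptotic {m : ℕ} {g : (Fin (m + m) → EuclideanSpace ℝ (Fin 3)) → ℝ}
    (hg : TendstoLocallyUniformlyOn (pairingRatio m) g (𝓝[>] (0 : ℝ)) (NonCoincident 3 (m + m)))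
    {x y : Fin (m + m) → EuclideanSpace ℝ (Fin 3)} (hx : x ∈ NonCoincident 3 (m + m))
    (hy : y ∈ NonCoincident 3 (m + m))
    (h : Tendsto (fun δ : ℝ => pairingRatio m δ y - pairingRatio m δ x) (𝓝[>] (0 : ℝ)) (𝓝 0)) :
    g y = g x :=
  eq_of_tendsto_sub (hg.tendsto_at hy) (hg.tendsto_at hx) h

/-- Conversely, equal limit values give asymptotically equal lattice ratios. -/
theorem asymptotic_of_limit_eq {m : ℕ} {g : (Fin (m + m) → EuclideanSpace ℝ (Fin 3)) → ℝ}
    (hg : TendstoLocallyUniformlyOn (pairingRatio m) g (𝓝[>] (0 : ℝ)) (NonCoincident 3 (m + m)))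
    {x y : Fin (m + m) → EuclideanSpace ℝ (Fin 3)} (hx : x ∈ NonCoincident 3 (m + m))
    (hy : y ∈ NonCoincident 3 (m + m)) (h : g y = g x) :
    Tendsto (fun δ : ℝ => pairingRatio m δ y - pairingRatio m δ x) (𝓝[>] (0 : ℝ)) (𝓝 0) := by
  have h' := (hg.tendsto_at hy).sub (hg.tendsto_at hx)
  rw [h, sub_self] at h'
  exact h'

/-- DILATION INVARIANCE IS FREE: a locally uniform ratio limit is invariant under `x ↦ c • x`, `c > 0`
(exact identity `pairingRatio_smul` + the mesh filter is dilation invariant). -/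
theorem limit_smul_eq {m : ℕ} {g : (Fin (m + m) → EuclideanSpace ℝ (Fin 3)) → ℝ}
    (hg : TendstoLocallyUniformlyOn (pairingRatio m) g (𝓝[>] (0 : ℝ)) (NonCoincident 3 (m + m)))
    {c : ℝ} (hc : 0 < c) {x : Fin (m + m) → EuclideanSpace ℝ (Fin 3)} (hx : x ∈ NonCoincident 3 (m + m))
    (hcx : (fun i => c • x i) ∈ NonCoincident 3 (m + m)) :
    g (fun i => c • x i) = g x := by
  have h1 : Tendsto (fun δ : ℝ => pairingRatio m δ (fun i => c • x i)) (𝓝[>] (0 : ℝ)) (𝓝 (g (fun i => c • x i))) :=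
    hg.tendsto_at hcx
  have h2 : Tendsto (fun δ : ℝ => pairingRatio m (δ / c) x) (𝓝[>] (0 : ℝ)) (𝓝 (g x)) :=
    (hg.tendsto_at hx).comp (tendsto_div_const_nhdsGT hc)
  have h3 : (fun δ : ℝ => pairingRatio m δ (fun i => c • x i)) = fun δ : ℝ => pairingRatio m (δ / c) x :=
    funext fun δ => pairingRatio_smul m δ c x
  rw [h3] at h1
  exact tendsto_nhds_unique h1 h2

/-! ## §5 Sorry-free glue, II: the free symmetries of ratio limits (translation, continuity, level 2, rotation) -/

section FreeSymmetries

variable {q : CorrFamily 3}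

/-- TRANSLATION INVARIANCE IS FREE (Stub 3 applied to the lattice-shift invariant cell functional `pairingRatio m`). -/
theorem ratioLimit_translate (hT : Sig.stub_cellLimitTranslate) {m : ℕ}
    (hq : TendstoLocallyUniformlyOn (pairingRatio m) (q (m + m)) (𝓝[>] (0 : ℝ)) (NonCoincident 3 (m + m)))
    (v : EuclideanSpace ℝ (Fin 3)) {x : Fin (m + m) → EuclideanSpace ℝ (Fin 3)}
    (hx : x ∈ NonCoincident 3 (m + m)) : q (m + m) (fun i => x i + v) = q (m + m) x :=
  hT (m + m) (pairingRatio m) (q (m + m)) (fun _ hδ x k => pairingRatio_shift hδ m x k) hq v x hx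

/-- CONTINUITY IS FREE (Stub 4 applied to `pairingRatio m`, translation invariance from Stub 3). -/
theorem ratioLimit_continuousOn (hT : Sig.stub_cellLimitTranslate) (hC : Sig.stub_cellLimitContinuous) {m : ℕ}
    (hq : TendstoLocallyUniformlyOn (pairingRatio m) (q (m + m)) (𝓝[>] (0 : ℝ)) (NonCoincident 3 (m + m))) :
    ContinuousOn (q (m + m)) (NonCoincident 3 (m + m)) :=
  hC (m + m) (pairingRatio m) (q (m + m)) (fun δ _ _ _ h => pairingRatio_cell m δ h)
    (fun v _ hx => ratioLimit_translate hT hq v hx) hq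

/-- DILATION INVARIANCE in the form consumed by Stub 6. -/
theorem ratioLimit_smul {m : ℕ}
    (hq : TendstoLocallyUniformlyOn (pairingRatio m) (q (m + m)) (𝓝[>] (0 : ℝ)) (NonCoincident 3 (m + m)))
    (c : ℝ) (hc : 0 < c) {x : Fin (m + m) → EuclideanSpace ℝ (Fin 3)} (hx : x ∈ NonCoincident 3 (m + m)) :
    q (m + m) (fun i => c • x i) = q (m + m) x :=
  limit_smul_eq hq hc hx ((comp_mem_nonCoincident_iff (smul_right_injective _ hc.ne') x).2 hx)

/-- At level `2 = 1 + 1` every ratio limit is `1` on the locus (`pairingRatio_one`). -/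
theorem ratioLimit_two (hq : TendstoLocallyUniformlyOn (pairingRatio 1) (q (1 + 1)) (𝓝[>] (0 : ℝ)) (NonCoincident 3 (1 + 1)))
    {x : Fin (1 + 1) → EuclideanSpace ℝ (Fin 3)} (hx : x ∈ NonCoincident 3 (1 + 1)) : q (1 + 1) x = 1 := by
  have h1 : Tendsto (fun δ : ℝ => pairingRatio 1 δ x) (𝓝[>] (0 : ℝ)) (𝓝 (q (1 + 1) x)) := hq.tendsto_at hx
  have h2 : Tendsto (fun δ : ℝ => pairingRatio 1 δ x) (𝓝[>] (0 : ℝ)) (𝓝 1) := by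
    simp only [pairingRatio_one]
    exact tendsto_const_nhds
  exact tendsto_nhds_unique h1 h2

/-- A pair `![a, b]` with `a ≠ b` is a non-coincident configuration of `1 + 1` points. -/
theorem pair_mem_nonCoincident' {a b : EuclideanSpace ℝ (Fin 3)} (h : a ≠ b) :
    (![a, b] : Fin (1 + 1) → EuclideanSpace ℝ (Fin 3)) ∈ NonCoincident 3 (1 + 1) := by
  rw [mem_nonCoincident]
  intro i j hij
  fin_cases i <;> fin_cases j
  · rfl
  · exact absurd hij h
  · exact absurd hij.symm h
  · rfl

/-- THE PINNED LIMIT: from ratio limits at every level, Stubs 3–6 build the pinned two-point limit `ψ` and the pinned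
scaling limit `S` (`S_{2m} = q_{2m} ∏ ψ`), which the landed `HyperoctahedralRP` theorems (`HRP2Rigidity_of`,
`limitRotationInvariant_proof`) make `O(3)` invariant. -/
theorem exists_pinnedLimit (hT : Sig.stub_cellLimitTranslate) (hC : Sig.stub_cellLimitContinuous)
    (h5 : Sig.stub_twoPointOfRatioLimit) (h6 : Sig.stub_scalingLimitOfRatioLimit)
    (hq : ∀ m : ℕ, TendstoLocallyUniformlyOn (pairingRatio m) (q (m + m)) (𝓝[>] (0 : ℝ)) (NonCoincident 3 (m + m))) :
    ∃ (ρ : ℝ → ℝ) (Δ : ℝ) (ψ : EuclideanSpace ℝ (Fin 3) → ℝ) (S : CorrFamily 3),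
      (∀ δ ∈ Set.Ioc (0 : ℝ) 1, 0 < ρ δ) ∧ HasPointwiseScalingLimit (criticalCorr 3) ρ S ∧
      (∀ (n : ℕ) (z : Fin n → EuclideanSpace ℝ (Fin 3)), z ∉ NonCoincident 3 n → S n z = 0) ∧
      IsNondegenerateTwoPoint S ∧ IsTranslationInvariant S ∧ IsScaleCovariant Δ S ∧ IsRotationInvariant S ∧
      (∀ u : EuclideanSpace ℝ (Fin 3), u ≠ 0 → 0 < ψ u) ∧
      (∀ m : ℕ, ∀ x ∈ NonCoincident 3 (m + m), S (m + m) x = q (m + m) x * ∏ j : Fin m, ψ (x (Fin.natAdd m j) - x (Fin.castAdd m j))) ∧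
      (∀ a b : EuclideanSpace ℝ (Fin 3), a ≠ b → S 2 ![a, b] = ψ (b - a)) := by
  -- the free inputs
  have hcont : ∀ m : ℕ, ContinuousOn (q (m + m)) (NonCoincident 3 (m + m)) :=
    fun m => ratioLimit_continuousOn hT hC (hq m)
  have htrans : ∀ (m : ℕ) (v : EuclideanSpace ℝ (Fin 3)), ∀ x ∈ NonCoincident 3 (m + m),
      q (m + m) (fun i => x i + v) = q (m + m) x := fun m v x hx => ratioLimit_translate hT (hq m) v hx
  have hdil : ∀ (m : ℕ) (c : ℝ), 0 < c → ∀ x ∈ NonCoincident 3 (m + m),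
      q (m + m) (fun i => c • x i) = q (m + m) x := fun m c hc x hx => ratioLimit_smul (hq m) c hc hx
  -- the pinned two-point limit and the pinned scaling limit
  obtain ⟨Δ, ψ, hψc, hψpos, hψhom, h2pt⟩ := h5 (q (2 + 2)) (hq 2) (hcont 2) (htrans 2)
  obtain ⟨ρ, S, hρ, hS, hnorm, hnd, htr, hsc, hform⟩ :=
    h6 q Δ ψ hq hcont htrans hdil hψc hψpos hψhom h2pt
  -- every such limit is `O(3)` invariant (route HyperoctahedralRP, items 1979/1980/8367, landed)
  have hrot : IsRotationInvariant S :=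
    Cruxes.LimitRotationInvariant.QuarterTurnLiouville.limitRotationInvariant_proof
      Cruxes.HRP2Rigidity.XRayMellin.HRP2Rigidity_of ρ Δ S hρ hS hnorm hnd htr hsc
  refine ⟨ρ, Δ, ψ, S, hρ, hS, hnorm, hnd, htr, hsc, hrot, hψpos, hform, ?_⟩
  -- `S 2 (a, b) = ψ (b - a)`
  intro a b hab
  have hc : (![a, b] : Fin (1 + 1) → EuclideanSpace ℝ (Fin 3)) ∈ NonCoincident 3 (1 + 1) := pair_mem_nonCoincident' hab
  have h1 := hform 1 _ hc
  rw [ratioLimit_two (hq 1) hc] at h1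
  have e3 : (![a, b] : Fin (1 + 1) → EuclideanSpace ℝ (Fin 3)) (Fin.natAdd 1 (0 : Fin 1)) = b := rfl
  have e4 : (![a, b] : Fin (1 + 1) → EuclideanSpace ℝ (Fin 3)) (Fin.castAdd 1 (0 : Fin 1)) = a := rfl
  simp only [Fin.prod_univ_one, one_mul, e3, e4] at h1
  exact h1

/-- The product of the paired norms is the product of all norms (the pairing covers every index once). -/
theorem prod_pair_norms (m : ℕ) (Δ : ℝ) (x : Fin (m + m) → EuclideanSpace ℝ (Fin 3)) :
    (∏ j : Fin m, ‖x (Fin.castAdd m j)‖ ^ (2 * Δ) * ‖x (Fin.natAdd m j)‖ ^ (2 * Δ)) =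
      ∏ i : Fin (m + m), ‖x i‖ ^ (2 * Δ) := by
  rw [Fin.prod_univ_add, Finset.prod_mul_distrib]

/-- `O(3)` INVARIANCE IS FREE: given ratio limits at every level, every `q (m+m)` is invariant under all linear
isometries on the locus (`q_{2m} = S_{2m}/∏ S_2` for the `O(3)`-invariant pinned limit `S`). -/
theorem ratioLimit_rotate (hT : Sig.stub_cellLimitTranslate) (hC : Sig.stub_cellLimitContinuous)
    (h5 : Sig.stub_twoPointOfRatioLimit) (h6 : Sig.stub_scalingLimitOfRatioLimit)
    (hq : ∀ m : ℕ, TendstoLocallyUniformlyOn (pairingRatio m) (q (m + m)) (𝓝[>] (0 : ℝ)) (NonCoincident 3 (m + m)))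
    (m : ℕ) (A : EuclideanSpace ℝ (Fin 3) ≃ₗᵢ[ℝ] EuclideanSpace ℝ (Fin 3))
    {x : Fin (m + m) → EuclideanSpace ℝ (Fin 3)} (hx : x ∈ NonCoincident 3 (m + m)) :
    q (m + m) (fun i => A (x i)) = q (m + m) x := by
  obtain ⟨ρ, Δ, ψ, S, -, -, -, -, -, -, hrot, hψpos, hform, hS2⟩ := exists_pinnedLimit hT hC h5 h6 hq
  -- the two-point kernel `ψ` is rotation invariant
  have hψrot : ∀ w : EuclideanSpace ℝ (Fin 3), w ≠ 0 → ψ (A w) = ψ w := by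
    intro w hw
    have h1 := hS2 0 w (Ne.symm hw)
    have h2 := hS2 (A 0) (A w) (fun h => hw (A.injective h).symm)
    have hcfg : (![A 0, A w] : Fin 2 → EuclideanSpace ℝ (Fin 3)) = fun i => A ((![0, w] : Fin 2 → EuclideanSpace ℝ (Fin 3)) i) := by
      funext i; fin_cases i <;> rfl
    rw [hcfg, hrot 2 A, h1, map_zero, sub_zero, sub_zero] at h2
    exact h2.symm
  -- compare the normal forms of `S (m+m)` at `x` and `A ∘ x`
  have hAx : (fun i => A (x i)) ∈ NonCoincident 3 (m + m) := (comp_mem_nonCoincident_iff A.injective x).2 hx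
  have h1 := hform m x hx
  have h2 := hform m _ hAx
  rw [hrot (m + m) A x, h1] at h2
  have hprod : (∏ j : Fin m, ψ ((fun i => A (x i)) (Fin.natAdd m j) - (fun i => A (x i)) (Fin.castAdd m j))) =
      ∏ j : Fin m, ψ (x (Fin.natAdd m j) - x (Fin.castAdd m j)) := by
    refine Finset.prod_congr rfl fun j _ => ?_
    show ψ (A (x (Fin.natAdd m j)) - A (x (Fin.castAdd m j))) = _
    rw [← map_sub, hψrot _ (pair_sub_ne_zero hx j)]
  rw [hprod] at h2
  have hP : (∏ j : Fin m, ψ (x (Fin.natAdd m j) - x (Fin.castAdd m j))) ≠ 0 :=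
    Finset.prod_ne_zero_iff.2 fun j _ => (hψpos _ (pair_sub_ne_zero hx j)).ne'
  exact (mul_right_cancel₀ hP h2).symm

/-- INVERSION FROM THE UPGRADE: given ratio limits at every level, the (open) crux
`HyperoctahedralRP.InversionUpgradeNormalised` (item stmt-CriticalPhenomena-1982) — every normalised non-degenerate
Euclidean-invariant scale-covariant pointwise scaling limit of the critical `ℤ³` correlators is inversion covariant —
applied to the pinned limit `S` makes every `q (m+m)` invariant under the unit inversion on the locus (the two-point
factors pick up exactly the weight `∏ ‖xᵢ‖^{2Δ}`, the pairing covering every index once). -/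
theorem ratioLimit_invert (hT : Sig.stub_cellLimitTranslate) (hC : Sig.stub_cellLimitContinuous)
    (h5 : Sig.stub_twoPointOfRatioLimit) (h6 : Sig.stub_scalingLimitOfRatioLimit)
    (hU : HyperoctahedralRP.InversionUpgradeNormalised)
    (hq : ∀ m : ℕ, TendstoLocallyUniformlyOn (pairingRatio m) (q (m + m)) (𝓝[>] (0 : ℝ)) (NonCoincident 3 (m + m)))
    (m : ℕ) {x : Fin (m + m) → EuclideanSpace ℝ (Fin 3)} (hx : x ∈ NonCoincident 3 (m + m)) (hx0 : ∀ i, x i ≠ 0) :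
    q (m + m) (fun i => EuclideanGeometry.inversion 0 1 (x i)) = q (m + m) x := by
  obtain ⟨ρ, Δ, ψ, S, hρ, hS, hnorm, hnd, htr, hsc, hrot, hψpos, hform, hS2⟩ := exists_pinnedLimit hT hC h5 h6 hq
  have hinv : IsInversionCovariant Δ S := hU ρ Δ S hρ hS hnorm hnd ⟨htr, hrot⟩ hsc
  have hι : Function.Injective (EuclideanGeometry.inversion (0 : EuclideanSpace ℝ (Fin 3)) 1) :=
    EuclideanGeometry.inversion_injective _ one_ne_zero
  -- two-point: `ψ (ι b - ι a) = ‖a‖^{2Δ} ‖b‖^{2Δ} ψ (b - a)`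
  have hψinv : ∀ a b : EuclideanSpace ℝ (Fin 3), a ≠ 0 → b ≠ 0 → a ≠ b →
      ψ (EuclideanGeometry.inversion 0 1 b - EuclideanGeometry.inversion 0 1 a) = ‖a‖ ^ (2 * Δ) * ‖b‖ ^ (2 * Δ) * ψ (b - a) := by
    intro a b ha hb hab
    have h1 := hS2 a b hab
    have h2 := hS2 _ _ (fun h => hab (hι h))
    have h3 := hinv 2 ![a, b] (fun i => by fin_cases i <;> assumption)
    have hcfg : (fun i => EuclideanGeometry.inversion 0 1 ((![a, b] : Fin 2 → EuclideanSpace ℝ (Fin 3)) i)) =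
        ![EuclideanGeometry.inversion 0 1 a, EuclideanGeometry.inversion 0 1 b] := by
      funext i; fin_cases i <;> rfl
    rw [hcfg, h2, h1, Fin.prod_univ_two] at h3
    simpa using h3
  -- level `m + m`
  have hιx : (fun i => EuclideanGeometry.inversion 0 1 (x i)) ∈ NonCoincident 3 (m + m) :=
    (comp_mem_nonCoincident_iff hι x).2 hx
  have h1 := hform m x hx
  have h2 := hform m _ hιx
  rw [hinv (m + m) x hx0, h1] at h2
  have hprod : (∏ j : Fin m, ψ ((fun i => EuclideanGeometry.inversion 0 1 (x i)) (Fin.natAdd m j) -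
      (fun i => EuclideanGeometry.inversion 0 1 (x i)) (Fin.castAdd m j))) =
      (∏ i : Fin (m + m), ‖x i‖ ^ (2 * Δ)) * ∏ j : Fin m, ψ (x (Fin.natAdd m j) - x (Fin.castAdd m j)) := by
    rw [← prod_pair_norms, ← Finset.prod_mul_distrib]
    refine Finset.prod_congr rfl fun j _ => ?_
    have hne : x (Fin.castAdd m j) ≠ x (Fin.natAdd m j) := fun h => pair_sub_ne_zero hx j (sub_eq_zero.2 h.symm)
    exact hψinv _ _ (hx0 _) (hx0 _) hne
  rw [hprod] at h2
  have hW : (∏ i : Fin (m + m), ‖x i‖ ^ (2 * Δ)) ≠ 0 :=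
    Finset.prod_ne_zero_iff.2 fun i _ => (Real.rpow_pos_of_pos (norm_pos_iff.2 (hx0 i)) _).ne'
  have hP : (∏ j : Fin m, ψ (x (Fin.natAdd m j) - x (Fin.castAdd m j))) ≠ 0 :=
    Finset.prod_ne_zero_iff.2 fun j _ => (hψpos _ (pair_sub_ne_zero hx j)).ne'
  -- `W * (q x * P) = q (ιx) * (W * P)`
  have h3 : q (m + m) x * ((∏ i : Fin (m + m), ‖x i‖ ^ (2 * Δ)) * ∏ j : Fin m, ψ (x (Fin.natAdd m j) - x (Fin.castAdd m j))) =
      q (m + m) (fun i => EuclideanGeometry.inversion 0 1 (x i)) *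
        ((∏ i : Fin (m + m), ‖x i‖ ^ (2 * Δ)) * ∏ j : Fin m, ψ (x (Fin.natAdd m j) - x (Fin.castAdd m j))) := by
    rw [← h2]
    ring
  exact (mul_right_cancel₀ (mul_ne_zero hW hP) h3).symm

end FreeSymmetries

/-! ## §6 Composition — the crux BY NAME from the six stubs (sorry-free) -/

/-- **COMPOSITION.** From a family `q` of locally uniform pairing-ratio limits (Stub 1) and the asymptotic lattice
invariance under the unit inversion (Stub 2) — translation invariance, continuity, the pinned two-point and scaling
limits being supplied by the provable Stubs 3–6, rotations by the landed `HyperoctahedralRP` rigidity, dilations by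
the exact identity `pairingRatio_smul` — the normalised family `normalise q` is Möbius covariant with weight `0` and
is still the locally uniform limit of the ratios on non-coincident configurations; this is
`Summit.CriticalPhenomena.Ising3DConformalLimit.Theses.LinkingParityCircles.SpinRatioMoebius` by name. -/
theorem SpinRatioMoebius_of :
    Sig.stub_ratioLimitExists → Sig.stub_ratioInversion → Sig.stub_cellLimitTranslate →
      Sig.stub_cellLimitContinuous → Sig.stub_twoPointOfRatioLimit → Sig.stub_scalingLimitOfRatioLimit →
      Summit.CriticalPhenomena.Ising3DConformalLimit.Theses.LinkingParityCircles.SpinRatioMoebius := by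
  intro hL hI hT hC h5 h6
  obtain ⟨q, hq⟩ := sig_ratioLimitExists_iff.1 hL
  have hI' := sig_ratioInversion_iff.1 hI
  refine ⟨normalise q, ⟨⟨?_, ?_⟩, ?_, ?_⟩, ?_⟩
  · -- translations (free)
    intro n v x
    have hφ : Function.Injective (fun y : EuclideanSpace ℝ (Fin 3) => y + v) := add_left_injective v
    by_cases h : Even n ∧ x ∈ NonCoincident 3 n
    · obtain ⟨⟨m, rfl⟩, hx⟩ := h
      have hxv : (fun i => x i + v) ∈ NonCoincident 3 (m + m) := (comp_mem_nonCoincident_iff hφ x).2 hx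
      rw [normalise_of_pos ⟨m, rfl⟩ hxv, normalise_of_pos ⟨m, rfl⟩ hx]
      exact ratioLimit_translate hT (hq m) v hx
    · have h' : ¬ (Even n ∧ (fun i => x i + v) ∈ NonCoincident 3 n) := fun hh =>
        h ⟨hh.1, (comp_mem_nonCoincident_iff hφ x).1 hh.2⟩
      rw [normalise_of_neg h', normalise_of_neg h]
  · -- linear isometries (free: HyperoctahedralRP rigidity)
    intro n A x
    by_cases h : Even n ∧ x ∈ NonCoincident 3 n
    · obtain ⟨⟨m, rfl⟩, hx⟩ := h
      have hAx : (fun i => A (x i)) ∈ NonCoincident 3 (m + m) := (comp_mem_nonCoincident_iff A.injective x).2 hx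
      rw [normalise_of_pos ⟨m, rfl⟩ hAx, normalise_of_pos ⟨m, rfl⟩ hx]
      exact ratioLimit_rotate hT hC h5 h6 hq m A hx
    · have h' : ¬ (Even n ∧ (fun i => A (x i)) ∈ NonCoincident 3 n) := fun hh =>
        h ⟨hh.1, (comp_mem_nonCoincident_iff A.injective x).1 hh.2⟩
      rw [normalise_of_neg h', normalise_of_neg h]
  · -- dilations, weight 0 (free)
    intro n c hc x
    have hc1 : c ^ (-(n : ℝ) * 0) = 1 := by
      rw [mul_zero, Real.rpow_zero]
    rw [hc1, one_mul]
    have hφ : Function.Injective (fun y : EuclideanSpace ℝ (Fin 3) => c • y) := smul_right_injective _ hc.ne'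
    by_cases h : Even n ∧ x ∈ NonCoincident 3 n
    · obtain ⟨⟨m, rfl⟩, hx⟩ := h
      have hcx : (fun i => c • x i) ∈ NonCoincident 3 (m + m) := (comp_mem_nonCoincident_iff hφ x).2 hx
      rw [normalise_of_pos ⟨m, rfl⟩ hcx, normalise_of_pos ⟨m, rfl⟩ hx]
      exact limit_smul_eq (hq m) hc hx hcx
    · have h' : ¬ (Even n ∧ (fun i => c • x i) ∈ NonCoincident 3 n) := fun hh =>
        h ⟨hh.1, (comp_mem_nonCoincident_iff hφ x).1 hh.2⟩
      rw [normalise_of_neg h', normalise_of_neg h]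
  · -- the unit inversion, weight 0 (Stub 2)
    intro n x hx0
    have hw : (∏ i : Fin n, ‖x i‖ ^ (2 * (0 : ℝ))) = 1 := by
      simp
    rw [hw, one_mul]
    have hφ : Function.Injective (EuclideanGeometry.inversion (0 : EuclideanSpace ℝ (Fin 3)) 1) :=
      EuclideanGeometry.inversion_injective _ one_ne_zero
    by_cases h : Even n ∧ x ∈ NonCoincident 3 n
    · obtain ⟨⟨m, rfl⟩, hx⟩ := h
      have hix : (fun i => EuclideanGeometry.inversion 0 1 (x i)) ∈ NonCoincident 3 (m + m) :=
        (comp_mem_nonCoincident_iff hφ x).2 hx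
      rw [normalise_of_pos ⟨m, rfl⟩ hix, normalise_of_pos ⟨m, rfl⟩ hx]
      exact limit_eq_of_asymptotic (hq m) hx hix (hI' m x hx hx0)
    · have h' : ¬ (Even n ∧ (fun i => EuclideanGeometry.inversion 0 1 (x i)) ∈ NonCoincident 3 n) := fun hh =>
        h ⟨hh.1, (comp_mem_nonCoincident_iff hφ x).1 hh.2⟩
      rw [normalise_of_neg h', normalise_of_neg h]
  · -- the convergence clause survives the normalisation (values changed only off the even non-coincident locus)
    intro m
    exact (hq m).congr_right fun x hx => (normalise_of_pos ⟨m, rfl⟩ hx).symm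

/-- The crux from the registered stubs (closed modulo exactly the two OPEN stubs `stub_ratioLimitExists`,
`stub_ratioInversion` and the four provable ones; kernel-checks that each `Sig.stub_X` IS the signature of `stub_X`). -/
theorem SpinRatioMoebius_of_stubs :
    Summit.CriticalPhenomena.Ising3DConformalLimit.Theses.LinkingParityCircles.SpinRatioMoebius :=
  SpinRatioMoebius_of stub_ratioLimitExists stub_ratioInversion stub_cellLimitTranslate stub_cellLimitContinuous
    stub_twoPointOfRatioLimit stub_scalingLimitOfRatioLimit

/-! ## §7 For the record: the birth stubs `stub_ratioTranslation`, `stub_ratioRotation` FOLLOW from convergence -/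

/-- The birth skeleton's translation stub is a consequence of the convergence stub (and the free Stub 3). -/
theorem ratioTranslation_of_ratioLimitExists (hT : Sig.stub_cellLimitTranslate) :
    Sig.stub_ratioLimitExists → Sig.stub_ratioTranslation := by
  intro hL
  obtain ⟨q, hq⟩ := sig_ratioLimitExists_iff.1 hL
  rw [sig_ratioTranslation_iff]
  intro m v x hx
  have hxv : (fun i => x i + v) ∈ NonCoincident 3 (m + m) :=
    (comp_mem_nonCoincident_iff (add_left_injective v) x).2 hx
  exact asymptotic_of_limit_eq (hq m) hx hxv (ratioLimit_translate hT (hq m) v hx)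

/-- The birth skeleton's rotation stub is a consequence of the convergence stub (and the free Stubs 3–6). -/
theorem ratioRotation_of_ratioLimitExists (hT : Sig.stub_cellLimitTranslate) (hC : Sig.stub_cellLimitContinuous)
    (h5 : Sig.stub_twoPointOfRatioLimit) (h6 : Sig.stub_scalingLimitOfRatioLimit) :
    Sig.stub_ratioLimitExists → Sig.stub_ratioRotation := by
  intro hL
  obtain ⟨q, hq⟩ := sig_ratioLimitExists_iff.1 hL
  rw [sig_ratioRotation_iff]
  intro m A x hx
  have hAx : (fun i => A (x i)) ∈ NonCoincident 3 (m + m) := (comp_mem_nonCoincident_iff A.injective x).2 hx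
  exact asymptotic_of_limit_eq (hq m) hx hAx (ratioLimit_rotate hT hC h5 h6 hq m A hx)

/-! ## §8 For the planners: the crux from TWO EXISTING OPEN ITEMS of sibling routes

With Euclidean invariance free, the remaining open content of the crux is (existence of the ratio limits) + (inversion).
The second is supplied by item stmt-CriticalPhenomena-1982 `HyperoctahedralRP.InversionUpgradeNormalised` applied to the
pinned limit; so `SpinRatioMoebius ⇐ stub_ratioLimitExists ∧ InversionUpgradeNormalised` (kernel-checked below). -/

/-- The birth skeleton's inversion stub is a consequence of the convergence stub and item 1982. -/
theorem ratioInversion_of_ratioLimitExists_of_upgrade :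
    Sig.stub_ratioLimitExists → HyperoctahedralRP.InversionUpgradeNormalised → Sig.stub_ratioInversion := by
  intro hL hU
  obtain ⟨q, hq⟩ := sig_ratioLimitExists_iff.1 hL
  rw [sig_ratioInversion_iff]
  intro m x hx hx0
  have hιx : (fun i => EuclideanGeometry.inversion 0 1 (x i)) ∈ NonCoincident 3 (m + m) :=
    (comp_mem_nonCoincident_iff (EuclideanGeometry.inversion_injective _ one_ne_zero) x).2 hx
  exact asymptotic_of_limit_eq (hq m) hx hιx
    (ratioLimit_invert stub_cellLimitTranslate stub_cellLimitContinuous stub_twoPointOfRatioLimit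
      stub_scalingLimitOfRatioLimit hU hq m hx hx0)

/-- **The crux from `stub_ratioLimitExists` and item 1982 alone** (everything else landed or free). -/
theorem SpinRatioMoebius_of_ratioLimitExists_of_inversionUpgrade :
    Sig.stub_ratioLimitExists → HyperoctahedralRP.InversionUpgradeNormalised →
      Summit.CriticalPhenomena.Ising3DConformalLimit.Theses.LinkingParityCircles.SpinRatioMoebius :=
  fun hL hU => SpinRatioMoebius_of hL (ratioInversion_of_ratioLimitExists_of_upgrade hL hU) stub_cellLimitTranslate
    stub_cellLimitContinuous stub_twoPointOfRatioLimit stub_scalingLimitOfRatioLimit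

/-- **The crux from the two OPEN items of the sibling routes alone**: item stmt-CriticalPhenomena-4841
`CurrentConnectionInvariance.RatioLimit` (⇒ `stub_ratioLimitExists`, landed bridge `ratioLimitExists_of_CCIRatioLimit`) and
item stmt-CriticalPhenomena-1982 `HyperoctahedralRP.InversionUpgradeNormalised` (⇒ `stub_ratioInversion` given the former). -/
theorem SpinRatioMoebius_of_CCIRatioLimit_of_inversionUpgrade :
    CurrentConnectionInvariance.RatioLimit → HyperoctahedralRP.InversionUpgradeNormalised →
      Summit.CriticalPhenomena.Ising3DConformalLimit.Theses.LinkingParityCircles.SpinRatioMoebius :=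
  fun hRL hU => SpinRatioMoebius_of_ratioLimitExists_of_inversionUpgrade (ratioLimitExists_of_CCIRatioLimit hRL) hU

end Summit.CriticalPhenomena.Ising3DConformalLimit.Cruxes.SpinRatioMoebius.Birth

end
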